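import Literature.MathematicalPhysics.QuantumFieldTheory.Balaban1983to89.B9Eq321LandauProjectionZd
import Literature.MathematicalPhysics.QuantumFieldTheory.Balaban1983to89.B8Ineq159GaugeCovariance

/-!
# `Balaban1983to89.B9Eq333ProjectionCovarianceZd` — [Balaban1985BackgroundPropagators] (3.28), (3.32)–(3.33) pp. 395–396 AT THE `ℤᵈ × 𝔸` CARRIER OF THE
# J-N06→N05 JUNCTION: the rotation `R(u)` of (3.28) on the carriers, the covariance (3.32) of the transported block averages
# `Q′_j(U₀) = QprimeIter (zdBlocking d L) (bgT L U₀) j` and of the null space `N_𝔤(Q′(U₀))`, and (3.33) `R(U₀^u)R(u) = R(u)R(U₀)` for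
# dag-n06-w4's CONSTRUCTED orthogonal projection `R(U₀)` (`B9Eq321LandauProjectionZd.projE ∕ projR`, (3.21)–(3.22))

statement-level skeleton of published theorems with citation tags; proofs where landed; nothing here is a claim about the
Yang–Mills mass gap

T. Bałaban, *Propagators for lattice gauge theories in a background field*, Commun. Math. Phys. **99** (1985) 389–434
[`Balaban1985BackgroundPropagators`, "B9"], journal page = PDF page + 388.  THE PRINT (p. 395, verbatim): *«if we make the transformations
U → U^u, U′ → R(u)U′, (3.28) where U^u(x, x′) = u(x)U(x, x′)u⁻¹(x′), (R(u)U′)(x, x′) = R(u(x))U′(x, x′) … The matrices in the definitions (3.19)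
transform as follows R(U^u(Γ^{(j)}_{y,x})) = R(u(y))R(U(Γ^{(j)}_{y,x}))R(u⁻¹(x)), hence (Q′_j(U^u)R(u)λ)(y) = R(u(y))(Q′_j(U)λ)(y), (3.32)»*;
p. 396: *«The equalities (3.31), (3.32) imply further G′(U^u) = R(u)G′(U)R(u⁻¹), R(U^u) = R(u)R(U)R(u⁻¹). (3.33)»*; p. 398 (after (3.47)): *«All these
inequalities are invariant with respect to gauge transformations of U»*; p. 396 (3.35): the regularity class is a statement about the gauge orbit
(«there exists a gauge transformation u … such that U^u = e^{iηA}»).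

CITATION HEADER ∕ WHY THIS FILE (cell `pub-ymgap`, HUMAN RULING D-0062 ∕ D-0149; width seat `pub-ymgap-dag-n06-w3` (g3), node N06 = [B9]; the
binder owner dag-n06-b g18 named «gauge covariance of `deltaAOf (opsAllZd …)`» as the open structural input (iii) of the per-member Theorem-3.11
road at the `ℤᵈ` carrier (pub-ymgap bus 2026-08-28 03:54Z), beside (ii) continuity (dag-n06-w4 g3); it is also the gauge-reduction step
(3.33)–(3.34)∕(3.36) of Theorem 3.3's proof).  In the tree (3.32)–(3.34) are typed on OTHER carriers — `B9Eq333Cov` (abstract intertwining model),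
`B9Eq333ProjectionCovariance` ∕ `B9Eq334LaplaceACovariance` (the pub-balaban NE9 chain's torus `ℓ²` carriers), `B9Eq332AvgCovariance` (lit-balaban's
`QpIter`), `OpsYGauge.deltaAY_cov` (node00-def-Y's letters) —, NOT for the objects of the `ℤᵈ × 𝔸` junction: dag-n06-w4's `R(U₀) = projE τ Ω₀ L m η Λs U₀`
(the `formE`-orthogonal projection onto `Δ^η_{U₀}N_𝔤(Q′(U₀))`, the null space read through THE KNIT's averages `QprimeIter (zdBlocking d L) (bgT L U₀)`).
THIS FILE proves (3.32) for exactly those averages and (3.33) for exactly that projection; the companion `B9Eq334GaugeCovarianceZd` assembles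
(3.34) for `Δ_a(U₀) = deltaAOf` and `G(U₀) = gopZd` from it.  INPUTS BY NAME: dag-n05-w3's `B8Ineq159GaugeCovariance` (`bgT_gaugeAct`,
`covLap_gaugeAct`, `indicator_rot`), `B7AvgGaugeCovariance.uLev`, dag-n06-w4's `B9Eq321LandauProjectionZd` (`suppSub ∕ formE ∕ gaugeNull ∕ rangeSub ∕
projE ∕ projR`, `star_conjR_of_mem_unitaryUnits`), Mathlib's `Submodule.projection`.

WHAT IS DECLARED ∕ PROVED (kernel, 0 sorry; three definitions with bodies — the rotations `R(u)` as ℝ-linear maps — and theorems; no `instance`,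
no `notation`).  `u : ℤᵈ → 𝔸ˣ` is ANY gauge function for the identities, UNITARY-valued where adjoints or the trace pairing enter; `U₀` ANY
background of units; `τ` tracial ∕ Hermitian ∕ faithful where `projE` is read as the projection.
* §1 `rotS u` (`(R(u)f)(z) = u(z)f(z)u(z)⁻¹` on `ℤᵈ → 𝔸`), `rotS_apply`, `rotS_inv_rotS ∕ rotS_rotS_inv`, `rotS_mem_suppSub`, `rotE u s` (its restriction to
  `L²(Ω₀, ·) = suppSub s`), `coe_rotE`, `rotE_inv_rotE ∕ rotE_rotE_inv`; fibre facts `re_trace_conj_pair` (`Re τ((R(v)a)*·R(v)b) = Re τ(a*b)`,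
  `v` unitary, `τ` tracial), `isSelfAdjoint_conjR`; ★ `formE_rotE` (the pairing (3.17) is `R(u)`-invariant).
* §2 ★★ `QprimeIter_gaugeAct` — (3.32) for the knit's averages: `(Q′_j(U₀^u)R(u)λ)(y) = R(u_j(y))(Q′_j(U₀)λ)(y)`, `u_j(y) = u(Lʲy)` (`uLev`), EVERY `u`,
  EVERY `U₀`, by induction on the levels from `bgT_gaugeAct`; ★ `rotS_mem_gaugeNull` (`R(u)N_𝔤(Q′(U₀)) ⊂ N_𝔤(Q′(U₀^u))`); `gaugeAct_inv_gaugeAct`.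
* §3 (3.33): `rotE_mem_rangeGen`, `map_rotE_rangeSub_le`, ★ `rangeSub_gaugeAct` (`Δ^η N_𝔤(Q′(U₀^u)) = R(u)·Δ^η N_𝔤(Q′(U₀))` as subspaces of `L²(Ω₀, ·)`),
  ★ `orthogonal_rangeSub_gaugeAct` (the same for the `formE`-orthogonal complements), ★★★ `projE_gaugeAct` (`R(U₀^u)(R(u)f) = R(u)(R(U₀)f)`), ★★★
  `projR_gaugeAct` (the same on functions `ℤᵈ → 𝔸`, Dirichlet restriction included).

HONEST SCOPE.  Conjugation algebra on landed objects; no estimate of [B9]; Theorems 3.3 ∕ 3.11 at curved `U₀` are NOT proved here; count-neutral;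
N05 ∕ N06 NOT discharged; K1⁷ `stmt-QuantumFields-20542` NOT closed; one finite `𝕋⁴` programme at fixed `ε`, Bałaban as printed; R4 closes only the
conditional finite-`𝕋⁴` rung `BalabanLadder.UV` — nothing continuum ∕ ℝ⁴ ∕ OS ∕ mass gap ∕ Clay.  Unit `pub-ymgap-dag-n06-w3` (g3), 2026-08-28.
-/

noncomputable section

namespace Literature.MathematicalPhysics.QuantumFieldTheory.Balaban1983to89.B9Eq333ProjectionCovarianceZd

open B7Prop1Explicit B7Eq78Linearization
open B7Prop2Explicit (unitaryUnits)
open B7AvgGaugeCovariance (uLev uLev_zero uLev_smul)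
open B8Ineq132 (conjR_conjR conjR_sum one_conjR)
open B8Eq119TwistedAxial (bgT)
open B8Eq138LandauZd (covLap)
open B8Ineq159GaugeCovariance (bgT_gaugeAct covLap_gaugeAct indicator_rot)
open B9Eq332AvgCovariance (conjR_inv_conjR)
open B9Eq321LandauProjectionZd
open Literature.MathematicalPhysics.QuantumLattice (blockSites blockBase)

-- `Site` alone could resolve to the torus sites of `Setup.lean`; re-export the `ℤ^d` sites of `B7Prop1Explicit`.
export B7Prop1Explicit (Site)

variable {d : ℕ} {𝔸 : Type*} [CStarAlgebra 𝔸]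

/-! ## §1  `R(u)` of (3.28) on functions `ℤᵈ → 𝔸` and on `L²(Ω₀, ·)`; the pairing is `R(u)`-invariant -/

section Rotation

variable (u : Site d → 𝔸ˣ)

/-- **`R(u)` ON FUNCTIONS `ℤᵈ → 𝔸`** ((3.28): `(R(u)λ)(x) = R(u(x))λ(x) = u(x)λ(x)u(x)⁻¹`), as an ℝ-linear map.
[cite: Balaban1985BackgroundPropagators, (3.28) p.395, p.390 («R(U)X = UXU⁻¹»)] -/
def rotS : (Site d → 𝔸) →ₗ[ℝ] (Site d → 𝔸) where
  toFun f := fun z => conjR (u z) (f z)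
  map_add' f g := by
    funext z
    exact conjR_add _ _ _
  map_smul' c f := by
    funext z
    exact conjR_smul_real _ _ _

/-- `R(u)`, unfolded. [cite: Balaban1985BackgroundPropagators, (3.28) p.395 (bookkeeping)] -/
theorem rotS_apply (f : Site d → 𝔸) (z : Site d) : rotS u f z = conjR (u z) (f z) := rfl

/-- `R(u⁻¹)R(u) = id`. [cite: Balaban1985BackgroundPropagators, (3.28) p.395 (bookkeeping)] -/
theorem rotS_inv_rotS (f : Site d → 𝔸) : rotS u⁻¹ (rotS u f) = f := by
  funext z
  exact conjR_inv_conjR (u z) (f z)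

/-- `R(u)R(u⁻¹) = id`. [cite: Balaban1985BackgroundPropagators, (3.28) p.395 (bookkeeping)] -/
theorem rotS_rotS_inv (f : Site d → 𝔸) : rotS u (rotS u⁻¹ f) = f := by
  have h := rotS_inv_rotS u⁻¹ f
  rwa [inv_inv] at h

/-- `R(u)` preserves the support condition of `L²(Ω₀, ·)`. [cite: Balaban1985BackgroundPropagators, (3.21) p.394 (bookkeeping)] -/
theorem rotS_mem_suppSub {s : Finset (Site d)} {f : Site d → 𝔸} (hf : f ∈ suppSub (𝔸 := 𝔸) s) : rotS u f ∈ suppSub (𝔸 := 𝔸) s := by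
  intro x hx
  rw [rotS_apply, hf x hx, conjR_apply, mul_zero, zero_mul]

/-- **`R(u)` ON `L²(Ω₀, ·)`** (the restriction of `rotS u` to `suppSub s`). [cite: Balaban1985BackgroundPropagators, (3.28) p.395, (3.21) p.394] -/
def rotE (s : Finset (Site d)) : suppSub (𝔸 := 𝔸) s →ₗ[ℝ] suppSub (𝔸 := 𝔸) s :=
  (rotS u).restrict fun _ hf => rotS_mem_suppSub u hf

/-- `rotE`, read back as a function. [cite: Balaban1985BackgroundPropagators, (3.28) p.395 (bookkeeping)] -/
theorem coe_rotE (s : Finset (Site d)) (f : suppSub (𝔸 := 𝔸) s) : (rotE u s f : Site d → 𝔸) = rotS u (f : Site d → 𝔸) := rfl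

/-- `R(u⁻¹)R(u) = id` on `L²(Ω₀, ·)`. [cite: Balaban1985BackgroundPropagators, (3.28) p.395 (bookkeeping)] -/
theorem rotE_inv_rotE (s : Finset (Site d)) (f : suppSub (𝔸 := 𝔸) s) : rotE u⁻¹ s (rotE u s f) = f :=
  Subtype.ext (rotS_inv_rotS u (f : Site d → 𝔸))

/-- `R(u)R(u⁻¹) = id` on `L²(Ω₀, ·)`. [cite: Balaban1985BackgroundPropagators, (3.28) p.395 (bookkeeping)] -/
theorem rotE_rotE_inv (s : Finset (Site d)) (f : suppSub (𝔸 := 𝔸) s) : rotE u s (rotE u⁻¹ s f) = f :=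
  Subtype.ext (rotS_rotS_inv u (f : Site d → 𝔸))

/-- `R(v)(ab) = R(v)a·R(v)b`. [folklore] -/
private theorem conjR_mul' (v : 𝔸ˣ) (a b : 𝔸) : conjR v (a * b) = conjR v a * conjR v b := by
  simp only [conjR_apply, mul_assoc, Units.inv_mul_cancel_left]

/-- **THE FIBRE PAIRING IS `R(v)`-INVARIANT**: `Re τ((R(v)a)*·R(v)b) = Re τ(a*b)` for a unitary `v` and a tracial `τ` (`(R(v)a)* = R(v)a*` and
`τ(vcv⁻¹) = τ(c)`). [cite: Balaban1985BackgroundPropagators, (3.30) p.395 («⟨R(u)A, J^u⟩ = ⟨A, J⟩»)] -/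
theorem re_trace_conj_pair (τ : 𝔸 →ₗ[ℂ] ℂ) (hτt : ∀ a b : 𝔸, τ (a * b) = τ (b * a)) {v : 𝔸ˣ} (hv : v ∈ unitaryUnits 𝔸) (a b : 𝔸) :
    (τ (star (conjR v a) * conjR v b)).re = (τ (star a * b)).re := by
  rw [star_conjR_of_mem_unitaryUnits hv, ← conjR_mul', conjR_apply, hτt, ← mul_assoc, Units.inv_mul, one_mul]

omit [CStarAlgebra 𝔸] in
/-- `R(v)a` is Hermitian for Hermitian `a` and unitary `v`. [cite: Balaban1985BackgroundPropagators, (3.21) p.394 («L²(Ω₀, 𝔤)»)] -/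
theorem isSelfAdjoint_conjR {𝔸 : Type*} [NormedRing 𝔸] [StarRing 𝔸] [NormedAlgebra ℂ 𝔸] {v : 𝔸ˣ} (hv : v ∈ unitaryUnits 𝔸) {a : 𝔸}
    (ha : IsSelfAdjoint a) : IsSelfAdjoint (conjR v a) := by
  rw [IsSelfAdjoint, star_conjR_of_mem_unitaryUnits hv, ha.star_eq]

/-- ★ **THE PAIRING OF `L²(Ω₀, ·)` IS `R(u)`-INVARIANT**: `⟨R(u)f, R(u)g⟩ = ⟨f, g⟩` for unitary `u` and tracial `τ`.
[cite: Balaban1985BackgroundPropagators, (3.30)–(3.31) p.395] -/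
theorem formE_rotE (τ : 𝔸 →ₗ[ℂ] ℂ) (hτt : ∀ a b : 𝔸, τ (a * b) = τ (b * a)) (hu : ∀ z, u z ∈ unitaryUnits 𝔸) (s : Finset (Site d))
    (f g : suppSub (𝔸 := 𝔸) s) : formE τ s (rotE u s f) (rotE u s g) = formE τ s f g := by
  rw [formE_apply, formE_apply]
  exact Finset.sum_congr rfl fun x _ => re_trace_conj_pair τ hτt (hu x) _ _

end Rotation

/-! ## §2  (3.32): the knit's transported averages `Q′_j(U₀)` and the null space `N_𝔤(Q′(U₀))` are gauge covariant -/

section Averages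

variable (L : ℕ) (u : Site d → 𝔸ˣ) (V : Site d → Fin d → 𝔸ˣ)

omit [CStarAlgebra 𝔸] in
/-- the block base point of the level-`(j+1)` site `y` is the level-`j` site `L·y`. [cite: Balaban1985Averaging, (78) p.30 (bookkeeping)] -/
theorem blockBase_eq_smul (y : Site d) : blockBase L y = (L : ℤ) • y := by
  funext i
  simp [blockBase, Pi.smul_apply]

/-- ★★ **(3.32) FOR THE KNIT'S AVERAGES**: `(Q′_j(U₀^u)R(u)λ)(y) = R(u_j(y))(Q′_j(U₀)λ)(y)` for `Q′_j(U₀) = QprimeIter (zdBlocking d L) (bgT L U₀) j`,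
with the level gauge `u_j(y) = u(Lʲy)` (`uLev`; the level-`j` site `y` IS the fine site `Lʲy`), for EVERY gauge function `u` and EVERY background `U₀` —
induction on `j`, each step by `bgT_gaugeAct` (`Ū^{u,j}(Γ_{Ly,x}) = u_j(Ly)Ūʲ(Γ_{Ly,x})u_j(x)⁻¹`).
[cite: Balaban1985BackgroundPropagators, (3.32) p.395, (3.19) p.393; Balaban1985Averaging, (11) p.19, (78)–(80) p.30] -/
theorem QprimeIter_gaugeAct :
    ∀ (j : ℕ) (lam : Site d → 𝔸) (y : Site d),
      QprimeIter (zdBlocking d L) (bgT L (gaugeAct u V)) j (fun z => conjR (u z) (lam z)) y =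
        conjR (uLev L u j y) (QprimeIter (zdBlocking d L) (bgT L V) j lam y)
  | 0, lam, y => by
    show conjR (u y) (lam y) = conjR (uLev L u 0 y) (lam y)
    rw [uLev_zero]
  | j + 1, lam, y => by
    rw [QprimeIter_succ, QprimeIter_succ]
    show Qprime (blockSites L y) (fun _ => ((L : ℝ) ^ d)⁻¹) (bgT L (gaugeAct u V) j y)
        (QprimeIter (zdBlocking d L) (bgT L (gaugeAct u V)) j (fun z => conjR (u z) (lam z))) =
      conjR (uLev L u (j + 1) y) (Qprime (blockSites L y) (fun _ => ((L : ℝ) ^ d)⁻¹) (bgT L V j y)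
        (QprimeIter (zdBlocking d L) (bgT L V) j lam))
    rw [Qprime_apply, Qprime_apply, conjR_sum]
    refine Finset.sum_congr rfl fun x _ => ?_
    rw [QprimeIter_gaugeAct j lam x, bgT_gaugeAct, conjR_smul_real, conjR_conjR, blockBase_eq_smul, uLev_smul,
      inv_mul_cancel_right, ← conjR_conjR]

/-- `(U₀^u)^{u⁻¹} = U₀`. [cite: Balaban1985Averaging, (8) p.18 (bookkeeping)] -/
theorem gaugeAct_inv_gaugeAct {G : Type*} [Group G] (w : Site d → G) (W : Site d → Fin d → G) : gaugeAct w⁻¹ (gaugeAct w W) = W := by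
  funext x μ
  simp only [gaugeAct, Pi.inv_apply, inv_inv]
  group

/-- `u⁻¹` is unitary-valued when `u` is. [cite: Balaban1985RegularSpaces, (1.1) p.76 (bookkeeping)] -/
theorem inv_mem_unitaryUnits {u : Site d → 𝔸ˣ} (hu : ∀ z, u z ∈ unitaryUnits 𝔸) (z : Site d) : u⁻¹ z ∈ unitaryUnits 𝔸 := by
  rw [Pi.inv_apply]
  exact Subgroup.inv_mem _ (hu z)

/-- ★ **`R(u)N_𝔤(Q′(U₀)) ⊂ N_𝔤(Q′(U₀^u))`**: a Hermitian gauge function supported in `Ω₀` and killed by the averages `Q′_j(U₀)` on `Λ_j`, `j ≤ m`,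
rotates to one killed by the `Q′_j(U₀^u)` ((3.32); `u` unitary for the Hermitian clause). [cite: Balaban1985BackgroundPropagators, (3.32) p.395, (3.21) p.394] -/
theorem rotS_mem_gaugeNull (hu : ∀ z, u z ∈ unitaryUnits 𝔸) {s : Finset (Site d)} {m : ℕ} {Λs : ℕ → Set (Site d)}
    {lam : Site d → 𝔸} (h : lam ∈ gaugeNull s L m Λs V) : rotS u lam ∈ gaugeNull s L m Λs (gaugeAct u V) := by
  obtain ⟨hsa, hsupp, hQ⟩ := h
  refine ⟨fun x => isSelfAdjoint_conjR (hu x) (hsa x), rotS_mem_suppSub u hsupp, fun j hj y hy => ?_⟩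
  show QprimeIter (zdBlocking d L) (bgT L (gaugeAct u V)) j (fun z => conjR (u z) (lam z)) y = 0
  rw [QprimeIter_gaugeAct, hQ j hj y hy, conjR_apply, mul_zero, zero_mul]

end Averages

/-! ## §3  (3.33): `R(U₀^u)R(u) = R(u)R(U₀)` for the constructed orthogonal projection -/

section Projection

variable (τ : 𝔸 →ₗ[ℂ] ℂ) (s : Finset (Site d)) (L m : ℕ) (η : ℝ) (Λs : ℕ → Set (Site d)) (u : Site d → 𝔸ˣ) (U₀ : Site d → Fin d → 𝔸ˣ)

/-- the generators rotate: `R(u)(𝟙_{Ω₀}Δ^η_{U₀}λ) = 𝟙_{Ω₀}Δ^η_{U₀^u}(R(u)λ)` with `R(u)λ ∈ N_𝔤(Q′(U₀^u))`.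
[cite: Balaban1985BackgroundPropagators, (3.31)–(3.32) p.395, (3.21) p.394] -/
theorem rotE_mem_rangeGen (hu : ∀ z, u z ∈ unitaryUnits 𝔸) {w : suppSub (𝔸 := 𝔸) s} (hw : w ∈ rangeGen s L m η Λs U₀) :
    rotE u s w ∈ rangeGen s L m η Λs (gaugeAct u U₀) := by
  obtain ⟨lam, hlam, hwlam⟩ := hw
  refine ⟨rotS u lam, rotS_mem_gaugeNull L u U₀ hu hlam, ?_⟩
  rw [coe_rotE, hwlam]
  funext z
  rw [rotS_apply, ← congrFun (indicator_rot u (↑s : Set (Site d)) (covLap η U₀ lam)) z]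
  congr 1
  funext x
  exact (covLap_gaugeAct η u U₀ lam x).symm

/-- `R(u)·Δ^η N_𝔤(Q′(U₀)) ≤ Δ^η N_𝔤(Q′(U₀^u))` (spans). [cite: Balaban1985BackgroundPropagators, (3.32)–(3.33) pp.395–396] -/
theorem map_rotE_rangeSub_le (hu : ∀ z, u z ∈ unitaryUnits 𝔸) :
    (rangeSub s L m η Λs U₀).map (rotE u s) ≤ rangeSub s L m η Λs (gaugeAct u U₀) := by
  rw [rangeSub, Submodule.map_span]
  refine Submodule.span_mono ?_
  rintro _ ⟨w, hw, rfl⟩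
  exact rotE_mem_rangeGen s L m η Λs u U₀ hu hw

/-- ★ **`Δ^η N_𝔤(Q′(U₀^u)) = R(u)·Δ^η N_𝔤(Q′(U₀))`** as subspaces of `L²(Ω₀, ·)` (the two inclusions: `u` on `U₀`, and `u⁻¹` on `U₀^u`).
[cite: Balaban1985BackgroundPropagators, (3.32)–(3.33) pp.395–396] -/
theorem rangeSub_gaugeAct (hu : ∀ z, u z ∈ unitaryUnits 𝔸) :
    rangeSub s L m η Λs (gaugeAct u U₀) = (rangeSub s L m η Λs U₀).map (rotE u s) := by
  refine le_antisymm (fun w hw => ?_) (map_rotE_rangeSub_le s L m η Λs u U₀ hu)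
  have h1 : rotE u⁻¹ s w ∈ rangeSub s L m η Λs U₀ := by
    have h2 := map_rotE_rangeSub_le s L m η Λs u⁻¹ (gaugeAct u U₀) (inv_mem_unitaryUnits hu) ⟨w, hw, rfl⟩
    rwa [gaugeAct_inv_gaugeAct] at h2
  exact ⟨rotE u⁻¹ s w, h1, rotE_rotE_inv u s w⟩

/-- ★ **THE ORTHOGONAL COMPLEMENTS ROTATE TOO**: `(Δ^η N_𝔤(Q′(U₀^u)))^⊥ = R(u)·(Δ^η N_𝔤(Q′(U₀)))^⊥` (`R(u)` preserves the pairing).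
[cite: Balaban1985BackgroundPropagators, (3.30)–(3.33) pp.395–396] -/
theorem orthogonal_rangeSub_gaugeAct (hτt : ∀ a b : 𝔸, τ (a * b) = τ (b * a)) (hu : ∀ z, u z ∈ unitaryUnits 𝔸) :
    (formE τ s).orthogonal (rangeSub s L m η Λs (gaugeAct u U₀)) = ((formE τ s).orthogonal (rangeSub s L m η Λs U₀)).map (rotE u s) := by
  have hu' : ∀ z, u⁻¹ z ∈ unitaryUnits 𝔸 := inv_mem_unitaryUnits hu
  ext g
  rw [rangeSub_gaugeAct s L m η Λs u U₀ hu, LinearMap.BilinForm.mem_orthogonal_iff, Submodule.mem_map]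
  constructor
  · intro hg
    refine ⟨rotE u⁻¹ s g, ?_, rotE_rotE_inv u s g⟩
    rw [LinearMap.BilinForm.mem_orthogonal_iff]
    intro w hw
    have h := hg (rotE u s w) ⟨w, hw, rfl⟩
    rw [← formE_rotE u τ hτt hu s w (rotE u⁻¹ s g), rotE_rotE_inv]
    exact h
  · rintro ⟨g₀, hg₀, rfl⟩ w ⟨w₀, hw₀, rfl⟩
    rw [LinearMap.BilinForm.mem_orthogonal_iff] at hg₀
    have h := hg₀ w₀ hw₀
    rw [formE_rotE u τ hτt hu s]
    exact h

/-- ★★★ **(3.33) FOR THE CONSTRUCTED PROJECTION: `R(U₀^u)(R(u)f) = R(u)(R(U₀)f)`** on `L²(Ω₀, ·)` — `τ` tracial, Hermitian, faithful on a finite-dimensional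
fibre (so that `projE` IS the projection onto `Δ^η N_𝔤(Q′(·))` along its `formE`-orthogonal complement, `projE_eq_projection`), `u` unitary, EVERY `U₀`:
both the range and the complement rotate (§3), and the projection is characterised by the decomposition.
[cite: Balaban1985BackgroundPropagators, (3.33) p.396, (3.21)–(3.22) p.394] -/
theorem projE_gaugeAct [FiniteDimensional ℝ 𝔸] (hτt : ∀ a b : 𝔸, τ (a * b) = τ (b * a))
    (hτs : ∀ a : 𝔸, τ (star a) = starRingEnd ℂ (τ a)) (hτp : ∀ a : 𝔸, a ≠ 0 → 0 < (τ (star a * a)).re)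
    (hu : ∀ z, u z ∈ unitaryUnits 𝔸) (f : suppSub (𝔸 := 𝔸) s) :
    projE τ s L m η Λs (gaugeAct u U₀) (rotE u s f) = rotE u s (projE τ s L m η Λs U₀ f) := by
  have hc := isCompl_rangeSub_orthogonal (s := s) (τ := τ) L m η Λs U₀ hτs hτp
  have hc' := isCompl_rangeSub_orthogonal (s := s) (τ := τ) L m η Λs (gaugeAct u U₀) hτs hτp
  rw [projE_eq_projection L m η Λs (gaugeAct u U₀) hτs hτp, projE_eq_projection L m η Λs U₀ hτs hτp]
  set P := (rangeSub s L m η Λs U₀).projection ((formE τ s).orthogonal (rangeSub s L m η Λs U₀)) hc with hP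
  -- the rotated `R(U₀)f` lies in the rotated range, the rotated residual in the rotated complement
  have hy : rotE u s (P f) ∈ rangeSub s L m η Λs (gaugeAct u U₀) := by
    rw [rangeSub_gaugeAct s L m η Λs u U₀ hu]
    exact ⟨P f, Submodule.projection_apply_mem hc f, rfl⟩
  have hz : rotE u s f - rotE u s (P f) ∈ (formE τ s).orthogonal (rangeSub s L m η Λs (gaugeAct u U₀)) := by
    rw [orthogonal_rangeSub_gaugeAct τ s L m η Λs u U₀ hτt hu, ← map_sub]
    exact ⟨f - P f, Submodule.sub_projection_mem hc f, rfl⟩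
  have hsplit : rotE u s f = rotE u s (P f) + (rotE u s f - rotE u s (P f)) := by abel
  rw [hsplit, map_add, Submodule.projection_apply_of_mem_left hc' hy, Submodule.projection_apply_of_mem_right hc' hz, add_zero]

/-- ★★★ **(3.33) ON FUNCTIONS `ℤᵈ → 𝔸`, DIRICHLET RESTRICTION INCLUDED**: `R(U₀^u)(R(u)f) = R(u)(R(U₀)f)` for dag-n06-w4's `projR` (restrict to `Ω₀`,
project, read back). [cite: Balaban1985BackgroundPropagators, (3.33) p.396, (3.24) p.394 («↾Ω₀»)] -/
theorem projR_gaugeAct [FiniteDimensional ℝ 𝔸] (hτt : ∀ a b : 𝔸, τ (a * b) = τ (b * a))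
    (hτs : ∀ a : 𝔸, τ (star a) = starRingEnd ℂ (τ a)) (hτp : ∀ a : 𝔸, a ≠ 0 → 0 < (τ (star a * a)).re)
    (hu : ∀ z, u z ∈ unitaryUnits 𝔸) (f : Site d → 𝔸) :
    projR τ s L m η Λs (gaugeAct u U₀) (fun z => conjR (u z) (f z)) = fun z => conjR (u z) (projR τ s L m η Λs U₀ f z) := by
  have hin : (⟨(↑s : Set (Site d)).indicator (fun z => conjR (u z) (f z)), indicator_mem_suppSub s _⟩ : suppSub (𝔸 := 𝔸) s) =
      rotE u s ⟨(↑s : Set (Site d)).indicator f, indicator_mem_suppSub s f⟩ := by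
    apply Subtype.ext
    rw [coe_rotE]
    funext z
    rw [rotS_apply]
    exact congrFun (indicator_rot u (↑s : Set (Site d)) f) z
  unfold projR
  rw [hin, projE_gaugeAct τ s L m η Λs u U₀ hτt hτs hτp hu]
  rfl

end Projection

end Literature.MathematicalPhysics.QuantumFieldTheory.Balaban1983to89.B9Eq333ProjectionCovarianceZd

end
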